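import Literature.AnabelianGeometry.AbsoluteAnabelian.AbsTopIII.KummerCuspLaws
import Literature.AnabelianGeometry.AbsoluteAnabelian.AbsTopIII.Thm19CuspidalDegree
import HarnessLib

/-!
# [AbsTopIII] §1: the `CurveModel` interface, layers V and VI of the law tower — v2 of the
# degree-TRANSPORT law (successor structures `SeparatedKummerModelV2`, `PlacedKummerModelV2`;
# statements only)

Mochizuki, *Topics in Absolute Anabelian Geometry III*, §1, Thm. 1.9 (d)(e) pp. 37–38, Prop. 1.6 (ii) p. 34,
Prop. 1.4 (i)(ii) p. 31, Prop. 1.8 (i) p. 36 (lit key `paper:url-5493eb38cbb7`).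

SUCCESSOR (abc-iut-L4-t1, owner of layers I–IV, under abc-iut-L4-lead RULINGS #7i/#7r) of the layers
V `KummerSeparationLaws.lean` (`SeparatedKummerModel`, p430090) and VI `KummerPlaceLaws.lean`
(`PlacedKummerModel`, p431901) of abc-iut-w5-d213, which STAY in the tree as superseded edges.  ONE field
changes — everything else is copied VERBATIM (docstrings included) so that consumers port by renaming:

* OWNER-READ FINDING F-t1g4-1 (abc-iut-L4-t1 gen 4): v1's (D-transport) `hasCuspidalDegree_transport`
  tests "the cusp `c_j` of `V_j` lies over the cusp `c_i` of `V_i`" along a factored transition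
  `t = (V_j ⊆ W) ≫ (W → V_i)` ONLY by decomposition-group containment `t(D_{c_j}) ⊆ g D_{c_i} g⁻¹`.  A cusp
  of `V_j` is of one of two kinds (Thm. 1.9 (d) p. 37: "`V` ranges over the open subschemes obtained by
  removing finite collections of NF-points from `Z ×_{k_Z} k′`"): (α) a cusp of `W = V_i ×_{k_i} k_j`,
  unramified over a cusp of `V_i`; (β) one of the removed points, `cuspPt hVW c_j = some y`.  In kind (β)
  the containment can still hold whenever a point's section sits inside a cuspidal decomposition group —
  e.g. over an algebraically closed base, where cuspidal decomposition groups ARE the inertia groups and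
  `t` kills `I_{c_j}` — and then the degrees read `n` versus `0`: v1 is FALSE at the intended étale-`π₁`
  model, which ranges over curves over ALL fields of characteristic zero.
* REPAIR (v2, the print-closest reading that survives `k = k̄` and adds NO law): the field now carries the
  hypothesis `cuspPt hVW c_j = none` — "`c_j` is a cusp of `W`", kind (α).  Then `t(I_{c_j})` is a full
  cuspidal inertia group of `V_i` lying in `g D_{c_i} g⁻¹ ∩ Δ_{V_i} = g I_{c_i} g⁻¹`, hence EQUAL to it
  (inertia groups of distinct cusps of a hyperbolic curve meet trivially, a closed subgroup conjugate into
  itself is equal to the conjugate; curves of genus `0`, the only non-hyperbolic candidates, carry no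
  `CuspSyncPresentation`), and the naturality of THE synchronization (Prop. 1.4 (ii); "a cyclotomic
  synchronization isomorphism [...] for any universal étale covering", Thm. 1.9 (b) p. 37) gives the
  invariance of degrees.  In the range of Thm. 1.9 — `Z_i` proper scheme-like of genus `≥ 2` over a
  Kummer-faithful field — the new hypothesis FOLLOWS from the decomposition containment by (S-fin) (kind
  (β) is contradictory there: companion `KummerSeparationLawsV2Proofs.lean`,
  `SeparatedKummerModelV2.cuspPt_eq_none_of_dcusp_map_le_conj`, so consumers keep v1's shape as the
  THEOREM `SeparatedKummerModelV2.hasCuspidalDegree_transport_of_dcusp`).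

Layer V (`SeparatedKummerModelV2`, three relations of the intended model, abc-iut-w5-d213's texts):
(S-fin) `point_eq_of_finiteIndex_le_conj`, (S-bcfin) `decomp_bcPt_finiteIndex`, (D-transport) v2.
Layer VI (`PlacedKummerModelV2`, abc-iut-w5-d213's three relations verbatim): (P-sat)
`nfPlace_eq_of_decomp_le`, (B×O-fibre) `exists_pt_bc_open`, (B-cusp-lift) `exists_cusp_above_bc`.
All six are TRUE relations of the intended model; no new Prop FACT is introduced; (S-fin) carries the
«OURS» mark of layer I's (S).  HONEST FRAMING: interface data; statements-first; typed ≠ proved; nothing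
here bears on [IUTchIII] Cor. 3.12.
-/

noncomputable section

open CategoryTheory
open scoped Pointwise

namespace Literature.AnabelianGeometry.AbsoluteAnabelian.AbsTopIII

universe u

/-- **The curve interface with separation and degree-transport laws, v2** (layer V over
`CoherentKummerModel`; successor of `SeparatedKummerModel`): (S-fin) finite-index subgroups of
decomposition groups of distinct closed points are not conjugate into one another (genus `≥ 2`,
scheme-like, Kummer-faithful base — OURS-derived from Prop. 1.6 (ii) as layer I's (S)); (S-bcfin) finite
index of decomposition groups along base-change legs; (D-transport, v2) invariance of cuspidal degrees
through THE synchronization along transitions, at cusps that are cusps of the intermediate base change.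
Interface data (relations of the intended model), no Prop-valued named fact.
[cite: MochizukiAbsTopIII2015, Thm 1.9 (e) p.38] -/
structure SeparatedKummerModelV2 : Type (u + 2) extends CoherentKummerModel.{u} where
  /-- (S-fin, OURS-derived from Prop. 1.6 (ii) p. 34 as layer I's (S)) SEPARATION: on a scheme-like curve of
  genus `≥ 2` over a Kummer-faithful field, a subgroup of FINITE index of `D_{x′}` lies in a conjugate of
  `D_x` only if `x′ = x` (injectivity of sections after the finite base change the subgroup cuts out). -/
  point_eq_of_finiteIndex_le_conj : ∀ (X : Curve), IsScheme X → 2 ≤ genus X →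
    IsKummerFaithful (base X) → ∀ (x x' : Point X) (H : Subgroup (ext X).arith) (g : (ext X).arith),
      H ≤ decomp X x' → H.relIndex (decomp X x') ≠ 0 → H ≤ MulAut.conj g • decomp X x → x' = x
  /-- (S-bcfin) along `Z′ = Z ×_k k′ → Z`, `D_{x′}` maps onto a FINITE-INDEX subgroup of a conjugate of
  `D_x`, `x` the image point ("`[k′(x′) : k(x)] < ∞`"; refines layer II's `decomp_bcPt`). -/
  decomp_bcPt_finiteIndex : ∀ {Z' Z : Curve} (h : IsBaseChangeOf Z' Z) (x' : Point Z'),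
    ∃ g : (ext Z).arith,
      (decomp Z' x').map (bc h).arith.toMonoidHom ≤ MulAut.conj g • decomp Z (bcPt h x') ∧
        ((decomp Z' x').map (bc h).arith.toMonoidHom).relIndex
            (MulAut.conj g • decomp Z (bcPt h x')) ≠ 0
  /-- (D-transport v2, Thm. 1.9 (b)(c)(d) p. 37: "a cyclotomic synchronization isomorphism [...] for any
  universal étale covering" — naturality of THE synchronization along the transitions of a system of
  NF-complements, which are unramified at their cusps) for a factored transition
  `t = (V_j ⊆ W) ≫ (W → V_i)` over the base-change leg `Z_j → Z_i` (commuting square `hsq`), presentations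
  `P_i`, `P_j`, a cusp `c_j` of `V_j` LYING OVER the cusp `c_i` of `V_i` (`t(D_{c_j}) ⊆ g D_{c_i} g⁻¹`) that
  is a CUSP OF `W` (`cuspPt hVW c_j = none`: not one of the finitely many points removed from
  `W = V_i ×_{k_i} k_j` — "removing finite collections of NF-points from `Z ×_{k_Z} k′`", (d) p. 37; v2,
  abc-iut-L4-t1 F-t1g4-1: without this hypothesis a removed point whose decomposition group happens to map
  into `g D_{c_i} g⁻¹`, e.g. over an algebraically closed base, reads degree `0` against `n`), and classes
  `η` (level `i`), `η′` (level `j`) with `(M_{Z_j} ⥲ M_{Z_i})_* η′ = t^* η`: `η` has degree `n` at `c_i` iff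
  `η′` has degree `n` at `c_j`.  In the range of Thm. 1.9 the cusp hypothesis follows from the containment
  (`SeparatedKummerModelV2.hasCuspidalDegree_transport_of_dcusp`). -/
  hasCuspidalDegree_transport : ∀ {Vj W Zj Vi Zi : Curve} (hVW : IsCofiniteOpen Vj W)
    (hWV : IsBaseChangeOf W Vi) (hj : IsCofiniteOpen Vj Zj) (hZZ : IsBaseChangeOf Zj Zi)
    (hi : IsCofiniteOpen Vi Zi) (hsq : (res hVW ≫ bc hWV) ≫ res hi = res hj ≫ bc hZZ)
    (Pi : toCurveModel.CuspSyncPresentation hi) (Pj : toCurveModel.CuspSyncPresentation hj)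
    (ci : (cusps Vi).Cusp) (cj : (cusps Vj).Cusp) (g : (ext Vi).arith),
    ((cusps Vj).Dcusp cj).map (res hVW ≫ bc hWV).arith.toMonoidHom ≤
      MulAut.conj g • (cusps Vi).Dcusp ci → cuspPt hVW cj = none →
    ∀ (η : cyclotomeModH1 (res hi) ZHatCoeff.{u}) (η' : cyclotomeModH1 (res hj) ZHatCoeff.{u}) (n : ℤ),
      (cyclotomeModH1Push ZHatCoeff.{u} (res hj) (bc hZZ)).hom η' =
        (cyclotomeModH1Pull ZHatCoeff.{u} (res hVW ≫ bc hWV) (res hi) (res hj ≫ bc hZZ) hsq).hom η →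
      (toCurveModel.HasCuspidalDegree Pi η ci n ↔ toCurveModel.HasCuspidalDegree Pj η' cj n)

/-- **The curve interface with the place law and the fibre / cusp-lifting laws, v2** (layer VI over
`SeparatedKummerModelV2`; successor of abc-iut-w5-d213's `PlacedKummerModel`, fields verbatim): (P-sat)
rational NF-points of levels whose decomposition groups map into `Δ_Z`-equivalent conjugates of `D_y` name
the same place of `K_{Z_NF}`; (B×O-fibre) `U ×_Z Z′` is the full preimage of `U`; (B-cusp-lift) cusps lift
along base-change legs.  Interface data (relations of the intended model), no Prop-valued named fact.
[cite: MochizukiAbsTopIII2015, Thm 1.9 (e) p.38] -/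
structure PlacedKummerModelV2 : Type (u + 2) extends SeparatedKummerModelV2.{u} where
  /-- (P-sat, Thm. 1.9 (e) / Prop. 1.3 (b) "`V_X ⥲ X(k)`": places = geometric points = double cosets
  `Δ_Z g D_y`) for a scheme-like `Z` of genus `≥ 2` over a Kummer-faithful field: a rational NF-point `x₁`
  of a base change `Z₁` and a rational NF-point `x₂` of a cofinite open `U₂` of a base change `Z₂` whose
  decomposition groups map into `(δ₁ g) D_y (δ₁ g)⁻¹`, resp. `(δ₂ g) D_y (δ₂ g)⁻¹`, with `δ₁, δ₂ ∈ Δ_Z`,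
  NAME THE SAME PLACE of `K_{Z_NF}/k̄_NF`. -/
  nfPlace_eq_of_decomp_le : ∀ {Z₁ U₂ Z₂ Z : Curve} (h₁ : IsBaseChangeOf Z₁ Z) (u₂ : IsCofiniteOpen U₂ Z₂)
    (h₂ : IsBaseChangeOf Z₂ Z), IsScheme Z → 2 ≤ genus Z → IsKummerFaithful (base Z) →
    ∀ (x₁ : Point Z₁) (hx₁ : IsNFPoint Z₁ x₁) (hr₁ : IsRationalPt Z₁ x₁) (x₂ : Point U₂)
      (hx₂ : IsNFPoint Z₂ (ptRes u₂ x₂)) (hr₂ : IsRationalPt Z₂ (ptRes u₂ x₂)) (y : Point Z)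
      (g δ₁ δ₂ : (ext Z).arith), δ₁ ∈ (ext Z).geom → δ₂ ∈ (ext Z).geom →
      (decomp Z₁ x₁).map (bc h₁).arith.toMonoidHom ≤ MulAut.conj (δ₁ * g) • decomp Z y →
      (decomp U₂ x₂).map (res u₂ ≫ bc h₂).arith.toMonoidHom ≤ MulAut.conj (δ₂ * g) • decomp Z y →
      nfPlace h₁ x₁ hx₁ hr₁ = nfPlace h₂ (ptRes u₂ x₂) hx₂ hr₂
  /-- (B×O-fibre) for `U′ = U ×_Z Z′ ⊆ Z′` over `U ⊆ Z`: a point of `Z′` over a point of `U` is a point of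
  `U′` (over that point). -/
  exists_pt_bc_open : ∀ {U U' Z Z' : Curve} (hU : IsBaseChangeOf U' U) (hZ : IsBaseChangeOf Z' Z)
    (h : IsCofiniteOpen U Z) (h' : IsCofiniteOpen U' Z') (x : Point U) (p : Point Z'),
    bcPt hZ p = ptRes h x → ∃ w : Point U', ptRes h' w = p ∧ bcPt hU w = x
  /-- (B-cusp-lift) along `Z′ = Z ×_k k′ → Z` every cusp of `Z` has a cusp of `Z′` above it. -/
  exists_cusp_above_bc : ∀ {Z' Z : Curve} (h : IsBaseChangeOf Z' Z) (c : (cusps Z).Cusp),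
    ∃ (c' : (cusps Z').Cusp) (g : (ext Z).arith),
      ((cusps Z').Dcusp c').map (bc h).arith.toMonoidHom ≤ MulAut.conj g • (cusps Z).Dcusp c

end Literature.AnabelianGeometry.AbsoluteAnabelian.AbsTopIII
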